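import Summits.BirchSwinnertonDyer.Rank1Residual.X11b.Three.ImageSpan
import Summits.BirchSwinnertonDyer.Rank1Residual.X11b.Three.MoritaDuality
import Mathlib.Algebra.Module.ZMod
import HarnessLib

/-!
# X11b at `p = 3` (team N8/O2), LINE-K sub-target E-K8 · IMG3-GEN (3/3): assembly — for
# `Γ ≤ GL₂(ℤ/p^{k+1})` with full mod-`p` image, every `Γ`-stable submodule / subgroup of `X ⊕ X`
# is `Y ⊕ Y` (cell `b2b-bsdres`, team `x11b3`, seat p2)

HONEST FRAMING (verbatim, cell `b2b-bsdres`, run/shared/lean/b2b/bsd-rank1-residual/): the goal of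
the cell is to DELETE the COMBINATION-SHAPED residual classes for ALL analytic-rank `≤ 1` curves
over `ℚ` — "full BSD formula for every rank `≤ 1` curve in class `C`" assembled STRICTLY from
published theorems — so that the rank-`≤ 1` remainder becomes exactly the CONSTRUCTION-SHAPED
classes, which are TYPED (missing-input Props), NOT attempted; this is not "finishing BSD".
Research route (team N8/O2: STEP L at `3 ‖ N`, LINE K); PURE ALGEBRA; nothing booked; no label
touched; X11b@3 stays OPEN (RESIDUAL-MAP §I O2). THEOREMS ONLY; no definition; no named fact;
no `sorry`.

## Why (LINE-K.md ⟦r2 05:57Z⟧ block 3, step U2 = McCallum 1991 §3 (2), surjectivity half;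
## sub-target E-K8 · IMG3-GEN, OWNERS.md claim ⟦x11b3-p2 GEN 2, 06:02Z⟧)

McCallum's structure theorem for `Ш(E/K)[p^∞]` (tree fact
`Literature/…/KolyvaginShaStructure.lean`, consumer `Three/McCallumCertificate.lean`) is printed
under "`Gal(ℚ(E_p)/ℚ) = GL₂(ℤ/p)`" and uses, at level `p^M`, that for `L = K(E_{p^M})` and every
finite `C ≤ H¹(K, E_{p^M})` one has `Gal(L_C/L) ≅ Hom(C, E_{p^M})` equivariantly. Besides
`H¹(L/K, E_{p^M}) = 0` (U1 — Sah, in the tree: `Three/ImageSah`, `Three/TorsionNegOneLift`,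
`Three/GaloisImageNegOne`) the proof needs that the image `Γ_M = ρ_{E,p^M}(G_K) ≤ GL₂(ℤ/p^M)`
GENERATES the matrix ring `M₂(ℤ/p^M)`, so that `Γ_M`-stable subgroups of
`Hom(C, E_{p^M}) ≅ Hom(C, ℤ/p^M)^{⊕ 2}` are `M₂`-submodules, hence of the form `Y ⊕ Y` (Morita),
and then `Y = Hom(C, ℤ/p^M)` by duality of finite groups. At `p = 3` the usual shortcut
"`p ∤ #Γ`" is dead (`3 ∣ #GL₂(𝔽₃) = 48`); none is needed: everything follows from the surjectivity
of the MOD-`p` representation ALONE (no `3`-adic tower hypothesis), for every prime `p` and every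
level `p^{k+1}`. The three files of E-K8: `Three/ImageSpan` (the span), `Three/MoritaDuality`
(Morita + duality), `Three/ImageGenerates` (assembly).

## What is proved here

* `GL2.mem_iff_forall_single_mem_of_forall_exists_map_eq` — `Γ ≤ GL₂(ℤ/p^{k+1})` with FULL
  mod-`p` image (hypothesis shape of `SerreSL2Lifting` / `exists_map_eq_of_hasSurjectiveModNGaloisRep`),
  `X` any `ℤ/p^{k+1}`-module, `W ≤ X ⊕ X` a `Γ`-stable submodule (action
  `(γ·v)_i = Σ_j γ_{ij} • v_j`) ⇒ `v ∈ W ↔ ∀ j, (v_j, 0) ∈ W`, i.e. `W = Y ⊕ Y`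
  (`ImageSpan.span_eq_top_of_subgroup` + `Morita`); primed form for additive subgroups
  (`AddSubgroup.toZModSubmodule`); `GL2.mem_iff_of_mulVec_mem` — the `X = ℤ/p^{k+1}`, `mulVec` form
  (the shape `e (σ • P) = ρ σ *ᵥ e P` of `exists_rep_of_addEquiv`): the `Γ`-stable subgroups of
  `E[p^{k+1}] ≅ (ℤ/p^{k+1})²` are the `I ⊕ I`; at `k = 0`, `E[p]` is an irreducible `Γ`-module;
  representation forms `GL2.mem_iff_forall_single_mem_of_rep` / `GL2.mem_iff_of_mulVec_mem_of_rep`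
  (hypothesis on `ρ : G →* GL₂(ℤ/p^{k+1})` exactly as output by
  `exists_map_eq_of_hasSurjectiveModNGaloisRep`).

Dictionary for the consumer (E-K9 / the McCallum binder downgrade, NOT done here): `Γ = ρ(G_K)`
for a frame of `E[3^M]` (`exists_rep_of_addEquiv`), hypothesis from `Surj W 3`
(`exists_map_eq_of_hasSurjectiveModNGaloisRep`, any base field of characteristic `≠ 3`; over `K`
the surjectivity of `ρ̄_{E,3}|_{G_K}` is `Three/ImageAtThreeField`), `X = Hom(C, ℤ/3^M)`, `W` = the
image of `Gal(L_C/L)`; this file gives `W = Y ⊕ Y`, `Duality.eq_top_of_forall_exists_apply_ne_zero`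
gives `Y = X` once the common kernel of `Y` is shown trivial from U1. What this file is NOT: no
Galois cohomology, no elliptic curve, no claim about any class; nothing booked.

References: W. G. McCallum, *Kolyvagin's work on Shafarevich–Tate groups*, in L-functions and
Arithmetic (Durham 1989), LMS LNS 153 (1991), §3 [McCallum1991]; J.-P. Serre, *Propriétés
galoisiennes des points d'ordre fini des courbes elliptiques*, Invent. Math. 15 (1972) §IV
[Serre1972]; S. Lang, *Algebra*, XVII §1 (modules over matrix rings) [Lang2002];
J. S. Milne, *Arithmetic Duality Theorems*, I §0 (0.19) [MilneADT2006]; team files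
`cells/x11b3/LINE-K.md` block 3 (U2, E-K8), `cells/x11b3/PLAN.md` §2.
-/

namespace Summit.BirchSwinnertonDyer.Rank1Residual.X11b.Three

open Matrix

/-! ## §4 Assembly at level `p^{k+1}`: `Γ`-stable submodules of `X ⊕ X` are `Y ⊕ Y` -/

namespace GL2

variable {p : ℕ} [Fact p.Prime] {k : ℕ}

/-- **E-K8 (U2, algebraic core).** Let `Γ ≤ GL₂(ℤ/p^{k+1})` have FULL image in `GL₂(𝔽_p)` and
let `W` be a `ℤ/p^{k+1}`-submodule of `X ⊕ X` (`X` any `ℤ/p^{k+1}`-module, e.g.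
`Hom(C, ℤ/p^{k+1})`) stable under `Γ` acting through the second factor,
`(γ·v)_i = Σ_j γ_{ij} • v_j`. Then `v ∈ W ↔ (∀ j, (v_j, 0) ∈ W)` — `W = Y ⊕ Y` with
`Y = {x | (x, 0) ∈ W}`. (§2: `Γ` spans `M₂`; §3: Morita.) EVERY prime `p`; the `p = 3` case is
LINE-K's. [folklore] -/
theorem mem_iff_forall_single_mem_of_forall_exists_map_eq
    (Γ : Subgroup (GL (Fin 2) (ZMod (p ^ (k + 1)))))
    (hΓ : ∀ t : GL (Fin 2) (ZMod p), ∃ g ∈ Γ,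
      Matrix.GeneralLinearGroup.map (ZMod.castHom (dvd_pow_self p k.succ_ne_zero) (ZMod p)) g
        = t)
    {X : Type*} [AddCommMonoid X] [Module (ZMod (p ^ (k + 1))) X]
    (W : Submodule (ZMod (p ^ (k + 1))) (Fin 2 → X))
    (hW : ∀ g ∈ Γ, ∀ v ∈ W,
      (fun i => ∑ j, (g : Matrix (Fin 2) (Fin 2) (ZMod (p ^ (k + 1)))) i j • v j) ∈ W)
    (v : Fin 2 → X) : v ∈ W ↔ ∀ j, (Pi.single 0 (v j) : Fin 2 → X) ∈ W := by
  refine Morita.mem_iff_forall_single_mem (W := W.toAddSubmonoid) (fun i j w hw => ?_) 0 v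
  refine Morita.single_apply_mem_of_span_eq_top (ImageSpan.span_eq_top_of_subgroup Γ hΓ) W
    ?_ i j w hw
  rintro _ ⟨g, hg, rfl⟩ u hu
  exact hW g hg u hu

/-- **E-K8, additive-subgroup form** (the consumer's `W` is a subgroup of the abelian group
`Hom(C, E[p^{k+1}])`; over `ℤ/p^{k+1}` subgroups are submodules, Mathlib
`AddSubgroup.toZModSubmodule`). [folklore] -/
theorem mem_iff_forall_single_mem_of_forall_exists_map_eq'
    (Γ : Subgroup (GL (Fin 2) (ZMod (p ^ (k + 1)))))
    (hΓ : ∀ t : GL (Fin 2) (ZMod p), ∃ g ∈ Γ,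
      Matrix.GeneralLinearGroup.map (ZMod.castHom (dvd_pow_self p k.succ_ne_zero) (ZMod p)) g
        = t)
    {X : Type*} [AddCommGroup X] [Module (ZMod (p ^ (k + 1))) X]
    (W : AddSubgroup (Fin 2 → X))
    (hW : ∀ g ∈ Γ, ∀ v ∈ W,
      (fun i => ∑ j, (g : Matrix (Fin 2) (Fin 2) (ZMod (p ^ (k + 1)))) i j • v j) ∈ W)
    (v : Fin 2 → X) : v ∈ W ↔ ∀ j, (Pi.single 0 (v j) : Fin 2 → X) ∈ W := by
  have h := mem_iff_forall_single_mem_of_forall_exists_map_eq Γ hΓ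
    (AddSubgroup.toZModSubmodule (p ^ (k + 1)) W)
    (fun g hg v hv => (AddSubgroup.mem_toZModSubmodule (p ^ (k + 1))).2
      (hW g hg v ((AddSubgroup.mem_toZModSubmodule (p ^ (k + 1))).1 hv))) v
  simpa only [AddSubgroup.mem_toZModSubmodule] using h

/-- **E-K8, vector form** (`X = ℤ/p^{k+1}`, action `Matrix.mulVec` — the shape of the framed
representation `e (σ • P) = ρ σ *ᵥ e P` of `exists_rep_of_addEquiv`): a `Γ`-stable additive
subgroup `W` of `(ℤ/p^{k+1})²` satisfies `v ∈ W ↔ ∀ j, (v_j, 0) ∈ W`; so the `Γ`-stable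
subgroups of `E[p^{k+1}]` are the `I ⊕ I`, `I` an ideal of `ℤ/p^{k+1}` — at `k = 0`:
`E[p]` is an irreducible `Γ`-module. [folklore] -/
theorem mem_iff_of_mulVec_mem (Γ : Subgroup (GL (Fin 2) (ZMod (p ^ (k + 1)))))
    (hΓ : ∀ t : GL (Fin 2) (ZMod p), ∃ g ∈ Γ,
      Matrix.GeneralLinearGroup.map (ZMod.castHom (dvd_pow_self p k.succ_ne_zero) (ZMod p)) g
        = t)
    (W : AddSubgroup (Fin 2 → ZMod (p ^ (k + 1))))
    (hW : ∀ g ∈ Γ, ∀ v ∈ W,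
      (g : Matrix (Fin 2) (Fin 2) (ZMod (p ^ (k + 1)))) *ᵥ v ∈ W)
    (v : Fin 2 → ZMod (p ^ (k + 1))) :
    v ∈ W ↔ ∀ j, (Pi.single 0 (v j) : Fin 2 → ZMod (p ^ (k + 1))) ∈ W := by
  refine mem_iff_forall_single_mem_of_forall_exists_map_eq' Γ hΓ W (fun g hg w hw => ?_) v
  rw [Morita.sum_smul_eq_mulVec]
  exact hW g hg w hw

/-- **E-K8, representation form** — hypothesis exactly as OUTPUT by
`EllipticCurves.exists_map_eq_of_hasSurjectiveModNGaloisRep`: `ρ : G →* GL₂(ℤ/p^{k+1})` with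
every `t ∈ GL₂(𝔽_p)` of the form `(ρ σ) mod p`; an additive subgroup `W ≤ X ⊕ X` stable under
every `ρ σ` (action `(γ·v)_i = Σ_j γ_{ij} • v_j`) satisfies `v ∈ W ↔ ∀ j, (v_j, 0) ∈ W`
(apply the subgroup form to the image `ρ(G)`). [folklore] -/
theorem mem_iff_forall_single_mem_of_rep {G : Type*} [Group G]
    (ρ : G →* GL (Fin 2) (ZMod (p ^ (k + 1))))
    (hρ : ∀ t : GL (Fin 2) (ZMod p), ∃ σ : G,
      Matrix.GeneralLinearGroup.map (ZMod.castHom (dvd_pow_self p k.succ_ne_zero) (ZMod p)) (ρ σ)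
        = t)
    {X : Type*} [AddCommGroup X] [Module (ZMod (p ^ (k + 1))) X]
    (W : AddSubgroup (Fin 2 → X))
    (hW : ∀ σ : G, ∀ v ∈ W,
      (fun i => ∑ j, (ρ σ : Matrix (Fin 2) (Fin 2) (ZMod (p ^ (k + 1)))) i j • v j) ∈ W)
    (v : Fin 2 → X) : v ∈ W ↔ ∀ j, (Pi.single 0 (v j) : Fin 2 → X) ∈ W := by
  refine mem_iff_forall_single_mem_of_forall_exists_map_eq' ρ.range (fun t => ?_) W ?_ v
  · obtain ⟨σ, hσ⟩ := hρ t
    exact ⟨ρ σ, ⟨σ, rfl⟩, hσ⟩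
  · rintro _ ⟨σ, rfl⟩ w hw
    exact hW σ w hw

/-- **E-K8, representation + `mulVec` form** (`X = ℤ/p^{k+1}`; the shape
`e (σ • P) = ρ σ *ᵥ e P` of `exists_rep_of_addEquiv`): a subgroup `W ≤ (ℤ/p^{k+1})²` stable under
every `ρ σ *ᵥ ·` satisfies `v ∈ W ↔ ∀ j, (v_j, 0) ∈ W` — after a frame: the `Γ_F`-stable
subgroups of `E[p^{k+1}]` are the `I ⊕ I` (`I` an ideal of `ℤ/p^{k+1}`) as soon as `ρ̄_{E,p}` is
onto. [folklore] -/
theorem mem_iff_of_mulVec_mem_of_rep {G : Type*} [Group G]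
    (ρ : G →* GL (Fin 2) (ZMod (p ^ (k + 1))))
    (hρ : ∀ t : GL (Fin 2) (ZMod p), ∃ σ : G,
      Matrix.GeneralLinearGroup.map (ZMod.castHom (dvd_pow_self p k.succ_ne_zero) (ZMod p)) (ρ σ)
        = t)
    (W : AddSubgroup (Fin 2 → ZMod (p ^ (k + 1))))
    (hW : ∀ σ : G, ∀ v ∈ W, (ρ σ : Matrix (Fin 2) (Fin 2) (ZMod (p ^ (k + 1)))) *ᵥ v ∈ W)
    (v : Fin 2 → ZMod (p ^ (k + 1))) :
    v ∈ W ↔ ∀ j, (Pi.single 0 (v j) : Fin 2 → ZMod (p ^ (k + 1))) ∈ W := by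
  refine mem_iff_of_mulVec_mem ρ.range (fun t => ?_) W ?_ v
  · obtain ⟨σ, hσ⟩ := hρ t
    exact ⟨ρ σ, ⟨σ, rfl⟩, hσ⟩
  · rintro _ ⟨σ, rfl⟩ w hw
    exact hW σ w hw

end GL2

end Summit.BirchSwinnertonDyer.Rank1Residual.X11b.Three
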